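import Literature.Probability.Percolation.MarkedLoopBoundaryLawModule
import Literature.Probability.LatticeModels.TemperleyLiebCapSpan
import HarnessLib

/-!
# Boundary span by induction on the number of marks: the cap-insertion criterion («BSPAN-INDUCTION-CRITERION»)

Topic `Literature/Probability/Percolation`; generic-`k` layer of the marked-loop (Khristoforov–Smirnov) lineage; a rider on `MarkedLoopBoundaryLawModule.lean` (the home-arc
boundary link-pattern law `lawLP z : LinkPattern (k+1) →₀ ℂ`, ★★★ `bNonvanish_last_iff_span_lawLP`) and on `LatticeModels/TemperleyLiebCapSpan.lean` (★★★
`span_eq_top_of_capInsL_mem_span`: a family of vectors of the planar module of `n+2` sites spans as soon as, for every cap position `j`, it contains in its span the cap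
insertions `capInsL j` of a spanning family of the module of `n` sites — every link pattern has a nearest-neighbour chord).

For `k = 2m+1` and `k + 2 = 2m+3` marks:

* ★★★ `bNonvanish_of_capInsL_laws` / `bSpan_of_capInsL_laws` — **THE INDUCTIVE CRITERION**: suppose that for every cap position `j` (`0 ≤ j ≤ k+1`) a family `S j` of home-arc
  boundary mid-edges of `k`-marked domains has laws spanning the planar module of `k+1` sites (e.g. all of them, if `BSpan k` is known and `S j` is everything; or the
  sub-family «with an insertion site in gap `j`»), and that for every member the CAP-INSERTED law `capInsL j (lawLP z)` lies in the span of the home-arc laws of all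
  `(k+2)`-marked domains; then `BNonvanish (k+2)` and `BSpan (k+2)` hold on the home arc — and ★★ `bSpan_of_capInsL_laws'` on every arc.

The second hypothesis is exactly what the one-hexagon decomposition F1 of the lane's tower calculus delivers (HOME `FINDING-BSPAN-TOWER-IDENTITY.md` §2, §4 (S3):
`capInsL j (law D̂) = law(D̂⁺ ⊕ h) − law(D̂⁺)` when `D̂` has an insertion site in gap `j`); F1 itself is NOT in this file.

## References
* M. Khristoforov, S. Smirnov, *Percolation and O(1) loop model*, arXiv:2111.15612 (2021), §1.2 (arXiv v1 p. 2: the law of the link pattern), §2 Lemma 4 (p. 4), eq. (4)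
  and Remark 6 (p. 5).
* P. A. Pearce, V. Rittenberg, J. de Gier, B. Nienhuis, *Temperley–Lieb stochastic processes*, J. Phys. A 35 (2002) L661–L668, §2 (link patterns).

## Mathlib / tree
Tree: `MarkedLoopBoundaryLawModule` (`lawLP`, `bNonvanish_last_iff_span_lawLP`), `MarkedLoopBoundarySpan` (`ArcPoint`, `BSpan`, `BNonvanish`, `bSpan_iff_bNonvanish`,
`bNonvanish_iff`), `LatticeModels/TemperleyLiebCapSpan` (`span_eq_top_of_capInsL_mem_span`), `LatticeModels/TemperleyLiebCapContract` (`capInsL`).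
-/

open Finset

namespace Literature.Probability.Percolation.MarkedLoops

open Literature.Probability.Percolation Literature.Probability.LatticeModels
open Literature.Probability.LatticeModels.TemperleyLieb
open TriMarkedDomain

section Induction

variable {m : ℕ}

/-- ★★★ **THE INDUCTIVE CRITERION FOR BOUNDARY NON-DEGENERACY** (`k = 2m+1 → k+2`): for every cap position `j` let `S j` be a set of home-arc boundary mid-edges of
`k`-marked domains whose laws span the planar module of `k+1` sites; if every cap-inserted law `capInsL j (lawLP z)`, `z ∈ S j`, lies in the span of the home-arc laws of the
`(k+2)`-marked domains, then `BNonvanish (k+2)` holds on the home arc. [cite: KhristoforovSmirnov2021, §2 Lemma 4 (arXiv v1 p. 4), eq. (4) and Remark 6 (p. 5); PearceRittenbergDeGierNienhuis2002, §2] -/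
theorem bNonvanish_of_capInsL_laws
    (S : Fin (2 * m + 2 + 1) → Set (Σ D : TriMarkedDomain (2 * m + 1), ArcPoint D (Fin.last (2 * m))))
    (hS : ∀ j, Submodule.span ℂ (Set.range fun zz : S j => lawLP zz.1.2) = ⊤)
    (hcap : ∀ j (zz : S j), capInsL ℂ j (lawLP zz.1.2) ∈
      Submodule.span ℂ (Set.range fun ww : (Σ D : TriMarkedDomain (2 * m + 2 + 1), ArcPoint D (Fin.last (2 * m + 2))) => lawLP ww.2)) :
    BNonvanish (2 * m + 2 + 1) (Fin.last (2 * m + 2)) := by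
  rw [bNonvanish_last_iff_span_lawLP]
  exact span_eq_top_of_capInsL_mem_span (fun ww : (Σ D : TriMarkedDomain (2 * m + 2 + 1), ArcPoint D (Fin.last (2 * m + 2))) => lawLP ww.2)
    (fun j (zz : S j) => lawLP zz.1.2) hS hcap

/-- ★★★ **… AND FOR BOUNDARY SPAN** on the home arc of the `(k+2)`-marked domains. [cite: KhristoforovSmirnov2021, §2 eq. (4) and Remark 6 (arXiv v1 p. 5); PearceRittenbergDeGierNienhuis2002, §2] -/
theorem bSpan_of_capInsL_laws
    (S : Fin (2 * m + 2 + 1) → Set (Σ D : TriMarkedDomain (2 * m + 1), ArcPoint D (Fin.last (2 * m))))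
    (hS : ∀ j, Submodule.span ℂ (Set.range fun zz : S j => lawLP zz.1.2) = ⊤)
    (hcap : ∀ j (zz : S j), capInsL ℂ j (lawLP zz.1.2) ∈
      Submodule.span ℂ (Set.range fun ww : (Σ D : TriMarkedDomain (2 * m + 2 + 1), ArcPoint D (Fin.last (2 * m + 2))) => lawLP ww.2)) :
    BSpan (2 * m + 2 + 1) (Fin.last (2 * m + 2)) :=
  (bSpan_iff_bNonvanish _).2 (bNonvanish_of_capInsL_laws S hS hcap)

/-- ★★ **… on EVERY arc** of the `(k+2)`-marked domains (arc independence). [cite: KhristoforovSmirnov2021, §1.2 (arXiv v1 p. 2: cyclic indexing); §2 eq. (4) (p. 5)] -/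
theorem bSpan_of_capInsL_laws'
    (S : Fin (2 * m + 2 + 1) → Set (Σ D : TriMarkedDomain (2 * m + 1), ArcPoint D (Fin.last (2 * m))))
    (hS : ∀ j, Submodule.span ℂ (Set.range fun zz : S j => lawLP zz.1.2) = ⊤)
    (hcap : ∀ j (zz : S j), capInsL ℂ j (lawLP zz.1.2) ∈
      Submodule.span ℂ (Set.range fun ww : (Σ D : TriMarkedDomain (2 * m + 2 + 1), ArcPoint D (Fin.last (2 * m + 2))) => lawLP ww.2))
    (a : Fin (2 * m + 2 + 1)) : BSpan (2 * m + 2 + 1) a ∧ BNonvanish (2 * m + 2 + 1) a := by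
  have h := bNonvanish_of_capInsL_laws S hS hcap
  have ha : BNonvanish (2 * m + 2 + 1) a := (bNonvanish_iff (n := 2 * m + 1) a (Fin.last (2 * m + 2))).2 h
  exact ⟨(bSpan_iff_bNonvanish a).2 ha, ha⟩

/-- ★ **the whole-family form**: if the laws of ALL `k`-marked domains span (e.g. `BSpan k` on the home arc) and every cap insertion of every such law lies in the span of the
`(k+2)`-laws, then `BSpan (k+2)` on every arc. [cite: KhristoforovSmirnov2021, §2 eq. (4) and Remark 6 (arXiv v1 p. 5); PearceRittenbergDeGierNienhuis2002, §2] -/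
theorem bSpan_succ_of_bSpan_of_capInsL (hlow : BNonvanish (2 * m + 1) (Fin.last (2 * m)))
    (hcap : ∀ (j : Fin (2 * m + 2 + 1)) (D : TriMarkedDomain (2 * m + 1)) (z : ArcPoint D (Fin.last (2 * m))), capInsL ℂ j (lawLP z) ∈
      Submodule.span ℂ (Set.range fun ww : (Σ D : TriMarkedDomain (2 * m + 2 + 1), ArcPoint D (Fin.last (2 * m + 2))) => lawLP ww.2))
    (a : Fin (2 * m + 2 + 1)) : BSpan (2 * m + 2 + 1) a ∧ BNonvanish (2 * m + 2 + 1) a := by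
  have hspan := bNonvanish_last_iff_span_lawLP.1 hlow
  refine bSpan_of_capInsL_laws' (fun _ => Set.univ) (fun j => ?_) (fun j zz => hcap j zz.1.1 zz.1.2) a
  -- the span over the whole family, re-indexed by `Set.univ`
  rw [← top_le_iff, ← hspan]
  refine Submodule.span_le.2 ?_
  rintro _ ⟨ww, rfl⟩
  exact Submodule.subset_span ⟨⟨ww, Set.mem_univ _⟩, rfl⟩

end Induction

end Literature.Probability.Percolation.MarkedLoops
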